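import Summits.AtomisticToContinuum.Crystallization.Theses.PricedLinkCensus
import Summits.AtomisticToContinuum.Crystallization.Theorems.PalmUnimodularRigidityPalmToHinge
import Summits.AtomisticToContinuum.Crystallization.Theorems.PalmUnimodularRigidityBenjaminiSchrammLimit
import Summits.AtomisticToContinuum.Crystallization.Theorems.PalmUnimodularRigidityCrysPeriodicBddBelow
import Summits.AtomisticToContinuum.Crystallization.Theorems.PalmUnimodularRigidityLayeredLawsSelectHcpRelaxedReference
import Summits.AtomisticToContinuum.Crystallization.Theorems.ExcessDecayLiouvilleCoarseGrainsHcpEnergySeries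
import Summits.AtomisticToContinuum.Crystallization.Theorems.PricedLinkCensusStackingHingeAllPointsOfRoot
import Summits.AtomisticToContinuum.Crystallization.Theorems.PricedLinkCensusStackingHingeRootSlpGood
import Summits.AtomisticToContinuum.Crystallization.Theorems.PricedLinkCensusStackingHingeAllPointsOfRootBond
import Summits.AtomisticToContinuum.Crystallization.Theorems.PricedLinkCensusStackingHingeRootBondShellGood
import Summits.AtomisticToContinuum.Crystallization.Theorems.PricedLinkCensusStackingHingeBarlowShellSupport
import Summits.AtomisticToContinuum.Crystallization.Theorems.PricedLinkCensusStackingHingeSingleOccupancy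
import Summits.AtomisticToContinuum.Crystallization.Theorems.PricedLinkCensusStackingHingeLocalBarlowStructure
import Summits.AtomisticToContinuum.Crystallization.Theorems.PricedLinkCensusStackingHingeExactWindowOfAllScales
import Summits.AtomisticToContinuum.Crystallization.Theorems.PricedLinkCensusStackingHingeAllPointsExact
import Summits.AtomisticToContinuum.Crystallization.Theorems.PricedLinkCensusStackingHingeHcpLocalExactRigid
import Summits.AtomisticToContinuum.Crystallization.Theorems.PricedLinkCensusStackingHingeHcpContinuationUnique
import Summits.AtomisticToContinuum.Crystallization.Theorems.PricedLinkCensusStackingHingeHcpRootTransitive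
import Summits.AtomisticToContinuum.Crystallization.Theorems.PricedLinkCensusStackingHingeHcpNetFacts

/-!
# Crux `PricedLinkCensus.StackingHinge` (stmt-AtomisticToContinuum-14993) from the SUPPORT form of the law-level core

Line `Sketch`, RESHAPE 11 (lead c4, 2026-08-17).  The composition of leads c2/c3 (Benjamini–Schramm limit `P` of the ground states,
`E_P[h] = e*`, transfer of `ChargeFreeWindows` + `SoftLayerPropagation` to "a.s. every point SLP-good and bond-shell-good", local
Barlow structure, density transfer) is LANDED here as ONE theorem `stub_gscpOfSupportCore : SupportCore → SoftLayerPropagation → ChargeFreeWindows →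
GroundStatesChargePeriodic` (corollary `stackingHinge_of_supportCore : SupportCore → StackingHinge`),
where `SupportCore` is the WEAKEST law-level statement the composition needs: for the global minimiser `(a₀, h₀)` of the relaxed-hcp
energy `hcpE`, a point-stationary hard-core law a.s. carried by everywhere-good configurations with mean root energy
`≤ hcpE a₀ h₀` and `≤ e(Q)` for every periodic `Q` charges, for every radius `R` and tolerance `θ > 0`, the event "the root `R`-window is two-way `θ`-matched to a rotated
`hcpStacking a₀ h₀`" — i.e. the rotated relaxed hcp crystal lies in the SUPPORT of `P`.  No almost-sure exactness, no coercive constant,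
no rigidity endgame is needed for the crux: `GroundStatesChargePeriodic` asks for a positive density `ρ(R, ε)` at every scale, which the
density-transfer clause of item 9230 delivers from `P(T) > 0` alone (`two_way_compose` does the bookkeeping).  Lead c3's registered
coercive floor `stub_slpLawCoerciveLS` remains a sufficient target: `stub_supportCoreOfCoerciveLS` derives the support core from it by
c3's landed rigidity chain (`stub_exactWindowOfAllScales`, `stub_allPointsExact`, `stub_hcpLocalExactRigid` + three net facts).
-/

noncomputable section

namespace Summit.AtomisticToContinuum.Crystallization.Theorems.PricedHcpWindowsSupportCore

open Literature.MathematicalPhysics.StatisticalMechanics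
open Literature.Geometry.DiscreteGeometry
open Summit.AtomisticToContinuum.Crystallization.Theses.PricedLinkCensus
open Summit.AtomisticToContinuum.Crystallization.Theses
open Filter Topology MeasureTheory Set

/-! ## The transferred predicates and the local structure (all inputs landed; copied from the line's skeleton v30) -/

/-- **lawSlpWindows** (the SLP transfer; its three stubs are landed: p133008, p133341, p132926): along a sequence of Lennard-Jones
ground states with charge-free windows a.e. and soft layer propagation, every Benjamini–Schramm limit law in the format of item 9230 is
a.s. carried by configurations ALL of whose points are SLP-good. [folklore] -/
theorem lawSlpWindows_holds : Summit.AtomisticToContinuum.Crystallization.Theses.PricedLinkCensus.SoftLayerPropagation → (∀ R : ℝ, 0 < R → ∀ x : (N : ℕ) → (Fin N → EuclideanSpace ℝ (Fin 3)), (∀ N, Literature.MathematicalPhysics.StatisticalMechanics.IsGroundState Literature.MathematicalPhysics.StatisticalMechanics.lennardJones (x N)) → Filter.Tendsto (fun N : ℕ => (Nat.card {i : Fin N // ¬ ∀ j : Fin N, dist (x N i) (x N j) ≤ R * Literature.Geometry.DiscreteGeometry.nearestDist (x N) i → Literature.Geometry.DiscreteGeometry.IsChargeFree (1 / 100 : ℝ)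 (x N) j} : ℝ) / N) Filter.atTop (nhds 0)) → ∀ x : (N : ℕ) → (Fin N → EuclideanSpace ℝ (Fin 3)), (∀ N, Literature.MathematicalPhysics.StatisticalMechanics.IsGroundState Literature.MathematicalPhysics.StatisticalMechanics.lennardJones (x N)) → ∀ φ : ℕ → ℕ, StrictMono φ → ∀ δ : ℝ, 0 < δ → ∀ P : MeasureTheory.Measure (MeasureTheory.Measure (EuclideanSpace ℝ (Fin 3))), MeasureTheory.IsProbabilityMeasure P → (∀ᵐ μ ∂P, (∃ S : Set (EuclideanSpace ℝ (Fin 3)), (0 : EuclideanSpace ℝ (Fin 3)) ∈ S ∧ (∀ x ∈ S, ∀ y ∈ S, x ≠ y → δ ≤ dist x y) ∧ μ = (MeasureTheory.Measure.count : MeasureTheory.Measure (EuclideanSpace ℝ (Fin 3))).restrict S)) → (∀ g : MeasureTheory.Measure (EuclideanSpace ℝ (Fin 3)) → EuclideanSpace ℝ (Fin 3) → ENNReal, Measurable (Function.uncurry g) → ∫⁻ μ, ∫⁻ y, g μ y ∂μ ∂P = ∫⁻ μ, ∫⁻ y, g (MeasureTheory.Measure.map (fun z => z - y) μ) (-y)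 ∂μ ∂P) → (∀ T : Set (MeasureTheory.Measure (EuclideanSpace ℝ (Fin 3))), ∀ R ε : ℝ, 0 < ε → ∀ ρ : ℝ, ρ < (P T).toReal → ∀ᶠ j : ℕ in Filter.atTop, ρ * (φ j : ℝ) ≤ (Nat.card {i : Fin (φ j) // ∃ ν ∈ T, ((∀ p : EuclideanSpace ℝ (Fin 3), ν {p} ≠ 0 → ‖p‖ ≤ R → ∃ q ∈ (Set.range (fun k : Fin (φ j) => x (φ j) k - x (φ j) i)), dist q p ≤ ε) ∧ (∀ q ∈ (Set.range (fun k : Fin (φ j) => x (φ j) k - x (φ j) i)), ‖q‖ ≤ R → ∃ p : EuclideanSpace ℝ (Fin 3), ν {p} ≠ 0 ∧ dist q p ≤ ε))} : ℝ)) → (∀ᵐ μ ∂P, ∃ S : Set (EuclideanSpace ℝ (Fin 3)), μ = (MeasureTheory.Measure.count : MeasureTheory.Measure (EuclideanSpace ℝ (Fin 3))).restrict S ∧ ∀ x ∈ S, (∀ t r : ℝ, Metric.infDist x (S \ {x}) / 6 < t → r < 3 * Metric.infDist x (S \ {x}) → ∃ s : ℤ → ℤ, Literature.MathematicalPhysics.StatisticalMechanics.IsHaggSeq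 s ∧ ∃ g : EuclideanSpace ℝ (Fin 3) ≃ᵃⁱ[ℝ] EuclideanSpace ℝ (Fin 3), (∀ y ∈ S, dist x y ≤ r → ∃ z ∈ Literature.MathematicalPhysics.StatisticalMechanics.barlowStacking (Metric.infDist x (S \ {x})) (Metric.infDist x (S \ {x}) * Real.sqrt (2 / 3)) s, dist y (g z) ≤ t) ∧ (∀ z ∈ Literature.MathematicalPhysics.StatisticalMechanics.barlowStacking (Metric.infDist x (S \ {x})) (Metric.infDist x (S \ {x}) * Real.sqrt (2 / 3)) s, dist x (g z) ≤ r → ∃ y ∈ S, dist y (g z) ≤ t))) :=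
  fun hSLP hCFW x hx φ hφ δ hδ P hP hcore hstat htr =>
    PricedHcpWindowsAllPointsOfRoot.stub_allPointsOfRoot δ hδ P hP hcore hstat
      (PricedHcpWindowsRootSlpGood.stub_rootSlpGoodCore hSLP hCFW x hx φ hφ δ hδ P hP hcore htr)

/-- **lawBondShell** (the 1 %-bond-shell transfer; stubs landed p134168, p135005): the same limit laws are a.s. carried by
configurations all of whose points are bond-shell-good. [folklore] -/
theorem lawBondShell_holds : Summit.AtomisticToContinuum.Crystallization.Theses.PricedLinkCensus.SoftLayerPropagation → (∀ R : ℝ, 0 < R → ∀ x : (N : ℕ) → (Fin N → EuclideanSpace ℝ (Fin 3)), (∀ N, Literature.MathematicalPhysics.StatisticalMechanics.IsGroundState Literature.MathematicalPhysics.StatisticalMechanics.lennardJones (x N)) → Filter.Tendsto (fun N : ℕ => (Nat.card {i : Fin N // ¬ ∀ j : Fin N, dist (x N i) (x N j) ≤ R * Literature.Geometry.DiscreteGeometry.nearestDist (x N) i → Literature.Geometry.DiscreteGeometry.IsChargeFree (1 / 100 : ℝ) (x N) j} : ℝ) / N) Filter.atTop (nhds 0)) → ∀ x : (N : ℕ)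 → (Fin N → EuclideanSpace ℝ (Fin 3)), (∀ N, Literature.MathematicalPhysics.StatisticalMechanics.IsGroundState Literature.MathematicalPhysics.StatisticalMechanics.lennardJones (x N)) → ∀ φ : ℕ → ℕ, StrictMono φ → ∀ δ : ℝ, 0 < δ → ∀ P : MeasureTheory.Measure (MeasureTheory.Measure (EuclideanSpace ℝ (Fin 3))), MeasureTheory.IsProbabilityMeasure P → (∀ᵐ μ ∂P, (∃ S : Set (EuclideanSpace ℝ (Fin 3)), (0 : EuclideanSpace ℝ (Fin 3)) ∈ S ∧ (∀ x ∈ S, ∀ y ∈ S, x ≠ y → δ ≤ dist x y) ∧ μ = (MeasureTheory.Measure.count : MeasureTheory.Measure (EuclideanSpace ℝ (Fin 3))).restrict S)) → (∀ g : MeasureTheory.Measure (EuclideanSpace ℝ (Fin 3)) → EuclideanSpace ℝ (Fin 3) → ENNReal, Measurable (Function.uncurry g) → ∫⁻ μ, ∫⁻ y, g μ y ∂μ ∂P = ∫⁻ μ, ∫⁻ y, g (MeasureTheory.Measure.map (fun z => z - y) μ) (-y) ∂μ ∂P) → (∀ T : Set (MeasureTheory.Measure (EuclideanSpace ℝ (Fin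 3))), ∀ R ε : ℝ, 0 < ε → ∀ ρ : ℝ, ρ < (P T).toReal → ∀ᶠ j : ℕ in Filter.atTop, ρ * (φ j : ℝ) ≤ (Nat.card {i : Fin (φ j) // ∃ ν ∈ T, ((∀ p : EuclideanSpace ℝ (Fin 3), ν {p} ≠ 0 → ‖p‖ ≤ R → ∃ q ∈ (Set.range (fun k : Fin (φ j) => x (φ j) k - x (φ j) i)), dist q p ≤ ε) ∧ (∀ q ∈ (Set.range (fun k : Fin (φ j) => x (φ j) k - x (φ j) i)), ‖q‖ ≤ R → ∃ p : EuclideanSpace ℝ (Fin 3), ν {p} ≠ 0 ∧ dist q p ≤ ε))} : ℝ)) → (∀ᵐ μ ∂P, ∃ S : Set (EuclideanSpace ℝ (Fin 3)), μ = (MeasureTheory.Measure.count : MeasureTheory.Measure (EuclideanSpace ℝ (Fin 3))).restrict S ∧ ∀ x ∈ S, ((∀ y ∈ S, y ≠ x → dist x y < 107 / 100 * Metric.infDist x (S \ {x}) → dist x y ≤ 101 / 100 * Metric.infDist x (S \ {x})) ∧ ∃ T : Finset (EuclideanSpace ℝ (Fin 3)), (↑T : Set (EuclideanSpace ℝ (Fin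 3))) ⊆ {y : EuclideanSpace ℝ (Fin 3) | y ∈ S ∧ y ≠ x ∧ dist x y ≤ 101 / 100 * Metric.infDist x (S \ {x})} ∧ T.card = 12)) :=
  fun hSLP hCFW x hx φ hφ δ hδ P hP hcore hstat htr =>
    PricedHcpWindowsAllPointsOfRootBond.stub_allPointsOfRootBond δ hδ P hP hcore hstat
      (PricedHcpWindowsRootBondShellGood.stub_rootBondShellGood hSLP hCFW x hx φ hφ δ hδ P hP hcore htr)

/-- **Both transferred predicates at once** (the set `S` is determined by `μ`, `eq_of_count_restrict_eq`). [folklore] -/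
theorem lawGood_holds : Summit.AtomisticToContinuum.Crystallization.Theses.PricedLinkCensus.SoftLayerPropagation → (∀ R : ℝ, 0 < R → ∀ x : (N : ℕ) → (Fin N → EuclideanSpace ℝ (Fin 3)), (∀ N, Literature.MathematicalPhysics.StatisticalMechanics.IsGroundState Literature.MathematicalPhysics.StatisticalMechanics.lennardJones (x N)) → Filter.Tendsto (fun N : ℕ => (Nat.card {i : Fin N // ¬ ∀ j : Fin N, dist (x N i) (x N j) ≤ R * Literature.Geometry.DiscreteGeometry.nearestDist (x N) i → Literature.Geometry.DiscreteGeometry.IsChargeFree (1 / 100 : ℝ) (x N) j} : ℝ) / N) Filter.atTop (nhds 0)) → ∀ x : (N : ℕ) → (Fin N → EuclideanSpace ℝ (Fin 3)), (∀ N, Literature.MathematicalPhysics.StatisticalMechanics.IsGroundState Literature.MathematicalPhysics.StatisticalMechanics.lennardJones (x N)) → ∀ φ : ℕ → ℕ, StrictMono φ → ∀ δ : ℝ, 0 < δ → ∀ P : MeasureTheory.Measure (MeasureTheory.Measure (EuclideanSpace ℝ (Fin 3))), MeasureTheory.IsProbabilityMeasure P → (∀ᵐ μ ∂P, (∃ S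 : Set (EuclideanSpace ℝ (Fin 3)), (0 : EuclideanSpace ℝ (Fin 3)) ∈ S ∧ (∀ x ∈ S, ∀ y ∈ S, x ≠ y → δ ≤ dist x y) ∧ μ = (MeasureTheory.Measure.count : MeasureTheory.Measure (EuclideanSpace ℝ (Fin 3))).restrict S)) → (∀ g : MeasureTheory.Measure (EuclideanSpace ℝ (Fin 3)) → EuclideanSpace ℝ (Fin 3) → ENNReal, Measurable (Function.uncurry g) → ∫⁻ μ, ∫⁻ y, g μ y ∂μ ∂P = ∫⁻ μ, ∫⁻ y, g (MeasureTheory.Measure.map (fun z => z - y) μ) (-y) ∂μ ∂P) → (∀ T : Set (MeasureTheory.Measure (EuclideanSpace ℝ (Fin 3))), ∀ R ε : ℝ, 0 < ε → ∀ ρ : ℝ, ρ < (P T).toReal → ∀ᶠ j : ℕ in Filter.atTop, ρ * (φ j : ℝ) ≤ (Nat.card {i : Fin (φ j) // ∃ ν ∈ T, ((∀ p : EuclideanSpace ℝ (Fin 3), ν {p} ≠ 0 → ‖p‖ ≤ R → ∃ q ∈ (Set.range (fun k : Fin (φ j) => x (φ j) k - x (φ j) i)), dist q p ≤ ε) ∧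 (∀ q ∈ (Set.range (fun k : Fin (φ j) => x (φ j) k - x (φ j) i)), ‖q‖ ≤ R → ∃ p : EuclideanSpace ℝ (Fin 3), ν {p} ≠ 0 ∧ dist q p ≤ ε))} : ℝ)) → (∀ᵐ μ ∂P, ∃ S : Set (EuclideanSpace ℝ (Fin 3)), μ = (MeasureTheory.Measure.count : MeasureTheory.Measure (EuclideanSpace ℝ (Fin 3))).restrict S ∧ ∀ x ∈ S, (∀ t r : ℝ, Metric.infDist x (S \ {x}) / 6 < t → r < 3 * Metric.infDist x (S \ {x}) → ∃ s : ℤ → ℤ, Literature.MathematicalPhysics.StatisticalMechanics.IsHaggSeq s ∧ ∃ g : EuclideanSpace ℝ (Fin 3) ≃ᵃⁱ[ℝ] EuclideanSpace ℝ (Fin 3), (∀ y ∈ S, dist x y ≤ r → ∃ z ∈ Literature.MathematicalPhysics.StatisticalMechanics.barlowStacking (Metric.infDist x (S \ {x})) (Metric.infDist x (S \ {x}) * Real.sqrt (2 / 3)) s, dist y (g z) ≤ t) ∧ (∀ z ∈ Literature.MathematicalPhysics.StatisticalMechanics.barlowStacking (Metric.infDist x (S \ {x})) (Metric.infDist x (S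 \ {x}) * Real.sqrt (2 / 3)) s, dist x (g z) ≤ r → ∃ y ∈ S, dist y (g z) ≤ t)) ∧ ((∀ y ∈ S, y ≠ x → dist x y < 107 / 100 * Metric.infDist x (S \ {x}) → dist x y ≤ 101 / 100 * Metric.infDist x (S \ {x})) ∧ ∃ T : Finset (EuclideanSpace ℝ (Fin 3)), (↑T : Set (EuclideanSpace ℝ (Fin 3))) ⊆ {y : EuclideanSpace ℝ (Fin 3) | y ∈ S ∧ y ≠ x ∧ dist x y ≤ 101 / 100 * Metric.infDist x (S \ {x})} ∧ T.card = 12)) := by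
  intro hSLP hCFW x hx φ hφ δ hδ P hP hcore hstat htr
  filter_upwards [lawSlpWindows_holds hSLP hCFW x hx φ hφ δ hδ P hP hcore hstat htr,
    lawBondShell_holds hSLP hCFW x hx φ hφ δ hδ P hP hcore hstat htr] with μ h1 h2
  obtain ⟨S, rfl, hS⟩ := h1
  obtain ⟨S', hS'eq, hS'⟩ := h2
  have hSS : S' = S := (PricedHcpWindowsAllPointsOfRoot.eq_of_count_restrict_eq hS'eq).symm
  subst hSS
  exact ⟨S', rfl, fun y hy => ⟨hS y hy, hS' y hy⟩⟩

/-- **Everywhere-good laws are a.s. locally Barlow with exact combinatorics** (the three landed geometry stubs p137271, p137299,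
p137456 applied inside `filter_upwards`). [folklore] -/
theorem lawLocalStructure_holds : ∀ δ : ℝ, 0 < δ → ∀ P : MeasureTheory.Measure (MeasureTheory.Measure (EuclideanSpace ℝ (Fin 3))), (∀ᵐ μ ∂P, (∃ S : Set (EuclideanSpace ℝ (Fin 3)), (0 : EuclideanSpace ℝ (Fin 3)) ∈ S ∧ (∀ x ∈ S, ∀ y ∈ S, x ≠ y → δ ≤ dist x y) ∧ μ = (MeasureTheory.Measure.count : MeasureTheory.Measure (EuclideanSpace ℝ (Fin 3))).restrict S)) → (∀ᵐ μ ∂P, ∃ S : Set (EuclideanSpace ℝ (Fin 3)), μ = (MeasureTheory.Measure.count : MeasureTheory.Measure (EuclideanSpace ℝ (Fin 3))).restrict S ∧ ∀ x ∈ S, (∀ t r : ℝ, Metric.infDist x (S \ {x}) / 6 < t → r < 3 * Metric.infDist x (S \ {x}) → ∃ s : ℤ → ℤ, Literature.MathematicalPhysics.StatisticalMechanics.IsHaggSeq s ∧ ∃ g : EuclideanSpace ℝ (Fin 3) ≃ᵃⁱ[ℝ] EuclideanSpace ℝ (Fin 3), (∀ y ∈ S, dist x y ≤ r → ∃ z ∈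 Literature.MathematicalPhysics.StatisticalMechanics.barlowStacking (Metric.infDist x (S \ {x})) (Metric.infDist x (S \ {x}) * Real.sqrt (2 / 3)) s, dist y (g z) ≤ t) ∧ (∀ z ∈ Literature.MathematicalPhysics.StatisticalMechanics.barlowStacking (Metric.infDist x (S \ {x})) (Metric.infDist x (S \ {x}) * Real.sqrt (2 / 3)) s, dist x (g z) ≤ r → ∃ y ∈ S, dist y (g z) ≤ t)) ∧ ((∀ y ∈ S, y ≠ x → dist x y < 107 / 100 * Metric.infDist x (S \ {x}) → dist x y ≤ 101 / 100 * Metric.infDist x (S \ {x})) ∧ ∃ T : Finset (EuclideanSpace ℝ (Fin 3)), (↑T : Set (EuclideanSpace ℝ (Fin 3))) ⊆ {y : EuclideanSpace ℝ (Fin 3) | y ∈ S ∧ y ≠ x ∧ dist x y ≤ 101 / 100 * Metric.infDist x (S \ {x})} ∧ T.card = 12)) → (∀ᵐ μ ∂P, ∃ S : Set (EuclideanSpace ℝ (Fin 3)), μ = (MeasureTheory.Measure.count : MeasureTheory.Measure (EuclideanSpace ℝ (Fin 3))).restrict S ∧ ∀ x ∈ S, ((∀ y ∈ S, dist x y ≤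 2 * Metric.infDist x (S \ {x}) → 13 / 20 * Metric.infDist x (S \ {x}) ≤ Metric.infDist y (S \ {y})) ∧ (∀ y ∈ S, y ≠ x → dist x y ≤ 101 / 100 * Metric.infDist x (S \ {x}) → dist x y ≤ 101 / 100 * Metric.infDist y (S \ {y})) ∧ ({y : EuclideanSpace ℝ (Fin 3) | y ∈ S ∧ y ≠ x ∧ dist x y ≤ 101 / 100 * Metric.infDist x (S \ {x})}.ncard = 12) ∧ (∀ t r : ℝ, Metric.infDist x (S \ {x}) / 6 < t → t ≤ 7 / 40 * Metric.infDist x (S \ {x}) → 29 / 10 * Metric.infDist x (S \ {x}) ≤ r → ∀ (s : ℤ → ℤ) (g : EuclideanSpace ℝ (Fin 3) ≃ᵃⁱ[ℝ] EuclideanSpace ℝ (Fin 3)), Literature.MathematicalPhysics.StatisticalMechanics.IsHaggSeq s → (∀ y ∈ S, dist x y ≤ r → ∃ z ∈ Literature.MathematicalPhysics.StatisticalMechanics.barlowStacking (Metric.infDist x (S \ {x})) (Metric.infDist x (S \ {x}) * Real.sqrt (2 / 3)) s, dist y (g z) ≤ t) → (∀ z ∈ Literature.MathematicalPhysics.StatisticalMechanics.barlowStacking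 (Metric.infDist x (S \ {x})) (Metric.infDist x (S \ {x}) * Real.sqrt (2 / 3)) s, dist x (g z) ≤ r → ∃ y ∈ S, dist y (g z) ≤ t) → ∀ y ∈ S, ∀ y' ∈ S, y ≠ x → dist x y ≤ 101 / 100 * Metric.infDist x (S \ {x}) → y' ≠ x → dist x y' ≤ 101 / 100 * Metric.infDist x (S \ {x}) → y ≠ y' → ∀ z ∈ Literature.MathematicalPhysics.StatisticalMechanics.barlowStacking (Metric.infDist x (S \ {x})) (Metric.infDist x (S \ {x}) * Real.sqrt (2 / 3)) s, ∀ z' ∈ Literature.MathematicalPhysics.StatisticalMechanics.barlowStacking (Metric.infDist x (S \ {x})) (Metric.infDist x (S \ {x}) * Real.sqrt (2 / 3)) s, dist y (g z) ≤ t → dist y' (g z') ≤ t → (dist y y' ≤ 101 / 100 * Metric.infDist y (S \ {y}) ↔ dist z z' = Metric.infDist x (S \ {x}))))) := by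
  intro δ hδ P hcore hgood
  filter_upwards [hcore, hgood] with μ hc hg
  obtain ⟨S, -, hsep, rfl⟩ := hc
  obtain ⟨S', hS', hG⟩ := hg
  obtain rfl := PricedHcpWindowsAllPointsOfRoot.eq_of_count_restrict_eq hS'
  exact ⟨S, rfl, PricedHcpWindowsLocalBarlowStructure.stub_localBarlowStructure
      (PricedHcpWindowsSingleOccupancy.stub_singleOccupancy PricedHcpWindowsBarlowShellSupport.stub_barlowShellSupport) δ hδ S hsep hG⟩

/-! ## Two-way matchings compose -/

/-- Two-way matchings compose, with radius loss `ε` and tolerances adding up: a window `W` two-way `ε/2`-matched with `S` within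
`R + ε`, and `S` two-way `ε/2`-matched with the rotated pattern `A '' H` within `R + ε`, give `W` two-way `ε`-matched with `A '' H`
within `R`. [folklore] -/
theorem two_way_compose {S W H : Set (EuclideanSpace ℝ (Fin 3))}
    (A : EuclideanSpace ℝ (Fin 3) ≃ₗᵢ[ℝ] EuclideanSpace ℝ (Fin 3)) {R ε : ℝ} (hε : 0 ≤ ε)
    (ha : ∀ p ∈ S, ‖p‖ ≤ R + ε → ∃ q ∈ W, dist q p ≤ ε / 2)
    (hb : ∀ q ∈ W, ‖q‖ ≤ R + ε → ∃ p ∈ S, dist q p ≤ ε / 2)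
    (hc : ∀ y ∈ S, ‖y‖ ≤ R + ε → ∃ z ∈ H, dist y (A z) ≤ ε / 2)
    (hd : ∀ z ∈ H, ‖z‖ ≤ R + ε → ∃ y ∈ S, dist y (A z) ≤ ε / 2) :
    (∀ s ∈ H, ‖s‖ ≤ R → ∃ q ∈ W, dist q (A s) ≤ ε) ∧
      (∀ q ∈ W, ‖q‖ ≤ R → ∃ s ∈ H, dist q (A s) ≤ ε) := by
  constructor
  · intro s hs hsR
    obtain ⟨y, hy, hys⟩ := hd s hs (by linarith)
    have hyR : ‖y‖ ≤ R + ε := by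
      have h1 : ‖y‖ ≤ dist y (A s) + ‖A s‖ := by
        simpa [dist_zero_right] using dist_triangle y (A s) 0
      rw [LinearIsometryEquiv.norm_map] at h1
      linarith
    obtain ⟨q, hq, hqy⟩ := ha y hy hyR
    refine ⟨q, hq, ?_⟩
    calc dist q (A s) ≤ dist q y + dist y (A s) := dist_triangle _ _ _
      _ ≤ ε / 2 + ε / 2 := add_le_add hqy hys
      _ = ε := by ring
  · intro q hq hqR
    obtain ⟨p, hp, hqp⟩ := hb q hq (by linarith)
    have hpR : ‖p‖ ≤ R + ε := by
      have h1 : ‖p‖ ≤ dist p q + ‖q‖ := by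
        simpa [dist_zero_right] using dist_triangle p q 0
      rw [dist_comm] at h1
      linarith
    obtain ⟨z, hz, hpz⟩ := hc p hp hpR
    refine ⟨z, hz, ?_⟩
    calc dist q (A z) ≤ dist q p + dist p (A z) := dist_triangle _ _ _
      _ ≤ ε / 2 + ε / 2 := add_le_add hqp hpz
      _ = ε := by ring

/-! ## The crux from the support core -/

/-- **`stub_gscpOfSupportCore` (RESHAPE 11, lead c4): the SUPPORT CORE gives the hinge.**  Hypothesis (the registered open stub
`stub_slpLawSupportCore` of the line, verbatim): for every `(a₀, h₀)` in the box `[189/200, 199/200] × [77/100, 163/200]` minimising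
`hcpE` globally, every hard core `δ > 0` and every probability law `P` on counting measures that is a.s. rooted `δ`-hard-core,
point-stationary (Mecke identity), a.s. carried by configurations all of whose points are SLP-good and bond-shell-good, a.s. locally
Barlow (scale comparability, symmetric bonds, twelve neighbours, exact links), has mean root energy `≤ hcpE a₀ h₀` AND `≤ e(Q)` for every
periodic configuration `Q` (both hold for the limit law: `E_P[h] = e*`), the event "the
root `R`-window is two-way `θ`-matched to `A '' hcpStacking a₀ h₀` for some linear isometry `A`" has non-zero (outer) `P`-measure for
all `R, θ > 0`.  Conclusion: `SoftLayerPropagation → ChargeFreeWindows → GroundStatesChargePeriodic` (the three route decls BY NAME;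
`StackingHinge` is this with the last two unfolded, `stackingHinge_of_supportCore` below).  Proof: Benjamini–Schramm limit of the ground states (item 9230), `E_P[h] = e* ≤
e(hcp a₀ h₀) = hcpE a₀ h₀` (item 0626, `ciInf_le`, `hcpEnergySeries_of_eq`, `stub_relaxedReference`), the transfers above, the core at
scale `(R + ε, ε/2)`, and the density-transfer clause of 9230 with `ρ = P(T)/2`, composed by `two_way_compose`. [folklore] -/
theorem stub_gscpOfSupportCore : (∀ a₀ h₀ : ℝ, 189 / 200 ≤ a₀ → a₀ ≤ 199 / 200 → 77 / 100 ≤ h₀ → h₀ ≤ 163 / 200 → (∀ a h : ℝ, 0 < a → 0 < h → Summit.AtomisticToContinuum.Crystallization.Theorems.PalmUnimodularRigidity.LayeredLawsSelectHcp.hcpE a₀ h₀ ≤ Summit.AtomisticToContinuum.Crystallization.Theorems.PalmUnimodularRigidity.LayeredLawsSelectHcp.hcpE a h) → ∀ δ : ℝ, 0 < δ → ∀ P : MeasureTheory.Measure (MeasureTheory.Measure (EuclideanSpace ℝ (Fin 3))), MeasureTheory.IsProbabilityMeasure P → (∀ᵐ μ ∂P, (∃ S : Set (EuclideanSpace ℝ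 (Fin 3)), (0 : EuclideanSpace ℝ (Fin 3)) ∈ S ∧ (∀ x ∈ S, ∀ y ∈ S, x ≠ y → δ ≤ dist x y) ∧ μ = (MeasureTheory.Measure.count : MeasureTheory.Measure (EuclideanSpace ℝ (Fin 3))).restrict S)) → (∀ g : MeasureTheory.Measure (EuclideanSpace ℝ (Fin 3)) → EuclideanSpace ℝ (Fin 3) → ENNReal, Measurable (Function.uncurry g) → ∫⁻ μ, ∫⁻ y, g μ y ∂μ ∂P = ∫⁻ μ, ∫⁻ y, g (MeasureTheory.Measure.map (fun z => z - y) μ) (-y) ∂μ ∂P) → (∀ᵐ μ ∂P, ∃ S : Set (EuclideanSpace ℝ (Fin 3)), μ = (MeasureTheory.Measure.count : MeasureTheory.Measure (EuclideanSpace ℝ (Fin 3))).restrict S ∧ ∀ x ∈ S, (∀ t r : ℝ, Metric.infDist x (S \ {x}) / 6 < t → r < 3 * Metric.infDist x (S \ {x}) → ∃ s : ℤ → ℤ, Literature.MathematicalPhysics.StatisticalMechanics.IsHaggSeq s ∧ ∃ g : EuclideanSpace ℝ (Fin 3) ≃ᵃⁱ[ℝ] EuclideanSpace ℝ (Fin 3),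 (∀ y ∈ S, dist x y ≤ r → ∃ z ∈ Literature.MathematicalPhysics.StatisticalMechanics.barlowStacking (Metric.infDist x (S \ {x})) (Metric.infDist x (S \ {x}) * Real.sqrt (2 / 3)) s, dist y (g z) ≤ t) ∧ (∀ z ∈ Literature.MathematicalPhysics.StatisticalMechanics.barlowStacking (Metric.infDist x (S \ {x})) (Metric.infDist x (S \ {x}) * Real.sqrt (2 / 3)) s, dist x (g z) ≤ r → ∃ y ∈ S, dist y (g z) ≤ t)) ∧ ((∀ y ∈ S, y ≠ x → dist x y < 107 / 100 * Metric.infDist x (S \ {x}) → dist x y ≤ 101 / 100 * Metric.infDist x (S \ {x})) ∧ ∃ T : Finset (EuclideanSpace ℝ (Fin 3)), (↑T : Set (EuclideanSpace ℝ (Fin 3))) ⊆ {y : EuclideanSpace ℝ (Fin 3) | y ∈ S ∧ y ≠ x ∧ dist x y ≤ 101 / 100 * Metric.infDist x (S \ {x})} ∧ T.card = 12)) → (∀ᵐ μ ∂P, ∃ S : Set (EuclideanSpace ℝ (Fin 3)), μ = (MeasureTheory.Measure.count : MeasureTheory.Measure (EuclideanSpace ℝ (Fin 3))).restrict S ∧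 ∀ x ∈ S, ((∀ y ∈ S, dist x y ≤ 2 * Metric.infDist x (S \ {x}) → 13 / 20 * Metric.infDist x (S \ {x}) ≤ Metric.infDist y (S \ {y})) ∧ (∀ y ∈ S, y ≠ x → dist x y ≤ 101 / 100 * Metric.infDist x (S \ {x}) → dist x y ≤ 101 / 100 * Metric.infDist y (S \ {y})) ∧ ({y : EuclideanSpace ℝ (Fin 3) | y ∈ S ∧ y ≠ x ∧ dist x y ≤ 101 / 100 * Metric.infDist x (S \ {x})}.ncard = 12) ∧ (∀ t r : ℝ, Metric.infDist x (S \ {x}) / 6 < t → t ≤ 7 / 40 * Metric.infDist x (S \ {x}) → 29 / 10 * Metric.infDist x (S \ {x}) ≤ r → ∀ (s : ℤ → ℤ) (g : EuclideanSpace ℝ (Fin 3) ≃ᵃⁱ[ℝ] EuclideanSpace ℝ (Fin 3)), Literature.MathematicalPhysics.StatisticalMechanics.IsHaggSeq s → (∀ y ∈ S, dist x y ≤ r → ∃ z ∈ Literature.MathematicalPhysics.StatisticalMechanics.barlowStacking (Metric.infDist x (S \ {x})) (Metric.infDist x (S \ {x}) * Real.sqrt (2 / 3)) s, dist y (g z)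 ≤ t) → (∀ z ∈ Literature.MathematicalPhysics.StatisticalMechanics.barlowStacking (Metric.infDist x (S \ {x})) (Metric.infDist x (S \ {x}) * Real.sqrt (2 / 3)) s, dist x (g z) ≤ r → ∃ y ∈ S, dist y (g z) ≤ t) → ∀ y ∈ S, ∀ y' ∈ S, y ≠ x → dist x y ≤ 101 / 100 * Metric.infDist x (S \ {x}) → y' ≠ x → dist x y' ≤ 101 / 100 * Metric.infDist x (S \ {x}) → y ≠ y' → ∀ z ∈ Literature.MathematicalPhysics.StatisticalMechanics.barlowStacking (Metric.infDist x (S \ {x})) (Metric.infDist x (S \ {x}) * Real.sqrt (2 / 3)) s, ∀ z' ∈ Literature.MathematicalPhysics.StatisticalMechanics.barlowStacking (Metric.infDist x (S \ {x})) (Metric.infDist x (S \ {x}) * Real.sqrt (2 / 3)) s, dist y (g z) ≤ t → dist y' (g z') ≤ t → (dist y y' ≤ 101 / 100 * Metric.infDist y (S \ {y}) ↔ dist z z' = Metric.infDist x (S \ {x}))))) → (∫ μ, (∫ y, Literature.MathematicalPhysics.StatisticalMechanics.lennardJones ‖y‖ ∂μ) / 2 ∂P) ≤ Summit.AtomisticToContinuum.Crystallization.Theorems.PalmUnimodularRigidity.LayeredLawsSelectHcp.hcpE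 a₀ h₀ → (∀ Q : Literature.MathematicalPhysics.StatisticalMechanics.PeriodicConfiguration 3, (∫ μ, (∫ y, Literature.MathematicalPhysics.StatisticalMechanics.lennardJones ‖y‖ ∂μ) / 2 ∂P) ≤ Q.energyPerParticle Literature.MathematicalPhysics.StatisticalMechanics.lennardJones) → ∀ R θ : ℝ, 0 < R → 0 < θ → P {μ | ∃ S : Set (EuclideanSpace ℝ (Fin 3)), μ = (MeasureTheory.Measure.count : MeasureTheory.Measure (EuclideanSpace ℝ (Fin 3))).restrict S ∧ ∃ A : EuclideanSpace ℝ (Fin 3) ≃ₗᵢ[ℝ] EuclideanSpace ℝ (Fin 3), (∀ y ∈ S, ‖y‖ ≤ R → ∃ z ∈ Literature.MathematicalPhysics.StatisticalMechanics.hcpStacking a₀ h₀, dist y (A z) ≤ θ) ∧ (∀ z ∈ Literature.MathematicalPhysics.StatisticalMechanics.hcpStacking a₀ h₀, ‖z‖ ≤ R → ∃ y ∈ S, dist y (A z) ≤ θ)} ≠ 0) → Summit.AtomisticToContinuum.Crystallization.Theses.PricedLinkCensus.SoftLayerPropagation → Summit.AtomisticToContinuum.Crystallization.Theses.PricedLinkCensus.ChargeFreeWindows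 → Summit.AtomisticToContinuum.Crystallization.Theses.PricedLinkCensus.GroundStatesChargePeriodic := by
  intro hCore hSLP hCFW x hx
  obtain ⟨φ, hφ, δ, hδ, P, hP, hcore, hstat, hE, htr⟩ :=
    Summit.AtomisticToContinuum.Crystallization.Theorems.benjaminiSchrammLimit_proof x hx
  have hlim' : Tendsto (fun j : ℕ => groundStateEnergy lennardJones 3 (φ j) / (φ j : ℝ)) atTop
      (𝓝 (⨅ Q : PeriodicConfiguration 3, Q.energyPerParticle lennardJones)) :=
    PalmUnimodularRigidity.CrysEnergyLimit_holds.comp hφ.tendsto_atTop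
  have hEq := tendsto_nhds_unique hE hlim'
  have hgood := lawGood_holds hSLP hCFW x hx φ hφ δ hδ P hP hcore hstat htr
  have hLS := lawLocalStructure_holds δ hδ P hcore hgood
  obtain ⟨a₀, h₀, ha1, ha2, hh1, hh2, hglob⟩ := PalmUnimodularRigidity.LayeredLawsSelectHcp.stub_relaxedReference
  have ha₀ : 0 < a₀ := by linarith
  have hh₀ : 0 < h₀ := by linarith
  -- `E_P[h] = e* ≤ e(hcp a₀ h₀) = hcpE a₀ h₀`
  have hEhcp : (hcpPeriodicConfiguration ha₀.ne' hh₀.ne').energyPerParticle lennardJones =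
      PalmUnimodularRigidity.LayeredLawsSelectHcp.hcpE a₀ h₀ :=
    (ExcessDecayLiouvilleCoarseGrains.hcpEnergySeries_of_eq a₀ h₀ ha₀.ne' hh₀.ne'
      PalmUnimodularRigidity.LayeredLawsSelectHcp.hcpQ rfl).2.2
  have hstar : (⨅ Q : PeriodicConfiguration 3, Q.energyPerParticle lennardJones) ≤
      (hcpPeriodicConfiguration ha₀.ne' hh₀.ne').energyPerParticle lennardJones :=
    ciInf_le Summit.AtomisticToContinuum.Crystallization.Theorems.crysPeriodicBddBelow_proof _
  have hle : (∫ μ, (∫ y, lennardJones ‖y‖ ∂μ) / 2 ∂P) ≤ PalmUnimodularRigidity.LayeredLawsSelectHcp.hcpE a₀ h₀ := by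
    rw [hEq, ← hEhcp]; exact hstar
  refine ⟨hcpPeriodicConfiguration ha₀.ne' hh₀.ne', ?_⟩
  intro R ε hR hε
  -- the support event at scale `(R + ε, ε / 2)` has non-zero mass
  set T : Set (MeasureTheory.Measure (EuclideanSpace ℝ (Fin 3))) := {μ | ∃ S : Set (EuclideanSpace ℝ (Fin 3)), μ = (MeasureTheory.Measure.count : MeasureTheory.Measure (EuclideanSpace ℝ (Fin 3))).restrict S ∧ ∃ A : EuclideanSpace ℝ (Fin 3) ≃ₗᵢ[ℝ] EuclideanSpace ℝ (Fin 3), (∀ y ∈ S, ‖y‖ ≤ R + ε → ∃ z ∈ Literature.MathematicalPhysics.StatisticalMechanics.hcpStacking a₀ h₀, dist y (A z) ≤ ε / 2) ∧ (∀ z ∈ Literature.MathematicalPhysics.StatisticalMechanics.hcpStacking a₀ h₀, ‖z‖ ≤ R + ε → ∃ y ∈ S, dist y (A z) ≤ ε / 2)} with hTdef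
  have hper : ∀ Q : PeriodicConfiguration 3, (∫ μ, (∫ y, lennardJones ‖y‖ ∂μ) / 2 ∂P) ≤ Q.energyPerParticle lennardJones :=
    fun Q => hEq.le.trans (ciInf_le Summit.AtomisticToContinuum.Crystallization.Theorems.crysPeriodicBddBelow_proof Q)
  have hT : P T ≠ 0 :=
    hCore a₀ h₀ ha1 ha2 hh1 hh2 hglob δ hδ P hP hcore hstat hgood hLS hle hper (R + ε) (ε / 2) (by positivity) (by positivity)
  have hTreal : 0 < (P T).toReal := ENNReal.toReal_pos hT (measure_ne_top P T)
  refine ⟨(P T).toReal / 2, half_pos hTreal, ?_⟩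
  have hev := htr T (R + ε) (ε / 2) (half_pos hε) ((P T).toReal / 2) (half_lt_self hTreal)
  set good : (N : ℕ) → Fin N → Prop := fun N i =>
    ∃ A : EuclideanSpace ℝ (Fin 3) →ₗᵢ[ℝ] EuclideanSpace ℝ (Fin 3),
      ∃ q ∈ (hcpPeriodicConfiguration ha₀.ne' hh₀.ne').points,
      (∀ s ∈ (hcpPeriodicConfiguration ha₀.ne' hh₀.ne').points, dist s q ≤ R →
        ∃ j : Fin N, dist (x N j) (x N i + A (s - q)) ≤ ε) ∧
      (∀ j : Fin N, dist (x N j) (x N i) ≤ R →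
        ∃ s ∈ (hcpPeriodicConfiguration ha₀.ne' hh₀.ne').points, dist (x N j) (x N i + A (s - q)) ≤ ε)
    with hgooddef
  have himp : ∀ (N : ℕ) (i : Fin N),
      (∃ ν ∈ T, ((∀ p : EuclideanSpace ℝ (Fin 3), ν {p} ≠ 0 → ‖p‖ ≤ R + ε →
          ∃ q ∈ (Set.range (fun k : Fin N => x N k - x N i)), dist q p ≤ ε / 2) ∧
        (∀ q ∈ (Set.range (fun k : Fin N => x N k - x N i)), ‖q‖ ≤ R + ε →
          ∃ p : EuclideanSpace ℝ (Fin 3), ν {p} ≠ 0 ∧ dist q p ≤ ε / 2))) → good N i := by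
    rintro N i ⟨ν, ⟨S, rfl, A, hc, hd⟩, h1, h2⟩
    have h1' : ∀ p ∈ S, ‖p‖ ≤ R + ε → ∃ q ∈ Set.range (fun k : Fin N => x N k - x N i), dist q p ≤ ε / 2 :=
      fun p hp => h1 p ((Literature.Probability.Process.count_restrict_singleton_ne_zero_iff _ p).2 hp)
    have h2' : ∀ q ∈ Set.range (fun k : Fin N => x N k - x N i), ‖q‖ ≤ R + ε → ∃ p ∈ S, dist q p ≤ ε / 2 := by
      intro q hq hqn
      obtain ⟨p, hp, hqp⟩ := h2 q hq hqn
      exact ⟨p, (Literature.Probability.Process.count_restrict_singleton_ne_zero_iff _ p).1 hp, hqp⟩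
    obtain ⟨c1, c2⟩ := two_way_compose A hε.le h1' h2' hc hd
    refine ⟨A.toLinearIsometry, 0, ?_, ?_, ?_⟩
    · rw [hcpPeriodicConfiguration_points]; exact PalmUnimodularRigidity.zero_mem_hcpStacking a₀ h₀
    · intro s hs hsq
      rw [hcpPeriodicConfiguration_points] at hs
      rw [dist_zero_right] at hsq
      obtain ⟨q, ⟨k, rfl⟩, hk⟩ := c1 s hs hsq
      refine ⟨k, ?_⟩
      have e1 : dist (x N k) (x N i + A.toLinearIsometry (s - 0)) = dist (x N k - x N i) (A s) := by
        simp only [sub_zero, LinearIsometryEquiv.coe_toLinearIsometry, dist_eq_norm, sub_add_eq_sub_sub]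
      rw [e1]; exact hk
    · intro j hj
      have hq : x N j - x N i ∈ Set.range (fun k : Fin N => x N k - x N i) := ⟨j, rfl⟩
      have hqn : ‖x N j - x N i‖ ≤ R := by rwa [← dist_eq_norm]
      obtain ⟨s, hs, hsd⟩ := c2 _ hq hqn
      refine ⟨s, ?_, ?_⟩
      · rw [hcpPeriodicConfiguration_points]; exact hs
      · have e1 : dist (x N j) (x N i + A.toLinearIsometry (s - 0)) = dist (x N j - x N i) (A s) := by
          simp only [sub_zero, LinearIsometryEquiv.coe_toLinearIsometry, dist_eq_norm, sub_add_eq_sub_sub]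
        rw [e1]; exact hsd
  have hev' : ∀ᶠ j : ℕ in atTop,
      (P T).toReal / 2 * ((φ j : ℕ) : ℝ) ≤ (Nat.card {i : Fin (φ j) // good (φ j) i} : ℝ) := by
    filter_upwards [hev] with j hj
    refine hj.trans ?_
    exact_mod_cast Nat.card_le_card_of_injective _
      (Subtype.map_injective (fun i hi => himp (φ j) i hi) Function.injective_id)
  exact hφ.tendsto_atTop.frequently
    (p := fun N : ℕ => (P T).toReal / 2 * (N : ℝ) ≤ (Nat.card {i : Fin N // good N i} : ℝ))
    hev'.frequently

/-- **The crux from the support core, by name**: `StackingHinge` is `SoftLayerPropagation → ChargeFreeWindows →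
GroundStatesChargePeriodic` with the last two decls unfolded (definitionally), so `stub_gscpOfSupportCore` is literally a proof of
`SupportCore → StackingHinge` — the one-line closer a proof of the support core (filed under any route) plugs into. [folklore] -/
theorem stackingHinge_of_supportCore (hCore : ∀ a₀ h₀ : ℝ, 189 / 200 ≤ a₀ → a₀ ≤ 199 / 200 → 77 / 100 ≤ h₀ → h₀ ≤ 163 / 200 → (∀ a h : ℝ, 0 < a → 0 < h → Summit.AtomisticToContinuum.Crystallization.Theorems.PalmUnimodularRigidity.LayeredLawsSelectHcp.hcpE a₀ h₀ ≤ Summit.AtomisticToContinuum.Crystallization.Theorems.PalmUnimodularRigidity.LayeredLawsSelectHcp.hcpE a h) → ∀ δ : ℝ, 0 < δ → ∀ P : MeasureTheory.Measure (MeasureTheory.Measure (EuclideanSpace ℝ (Fin 3))), MeasureTheory.IsProbabilityMeasure P → (∀ᵐ μ ∂P, (∃ S : Set (EuclideanSpace ℝ (Fin 3)), (0 : EuclideanSpace ℝ (Fin 3)) ∈ S ∧ (∀ x ∈ S, ∀ y ∈ S, x ≠ y → δ ≤ dist x y) ∧ μ = (MeasureTheory.Measure.count : MeasureTheory.Measure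 (EuclideanSpace ℝ (Fin 3))).restrict S)) → (∀ g : MeasureTheory.Measure (EuclideanSpace ℝ (Fin 3)) → EuclideanSpace ℝ (Fin 3) → ENNReal, Measurable (Function.uncurry g) → ∫⁻ μ, ∫⁻ y, g μ y ∂μ ∂P = ∫⁻ μ, ∫⁻ y, g (MeasureTheory.Measure.map (fun z => z - y) μ) (-y) ∂μ ∂P) → (∀ᵐ μ ∂P, ∃ S : Set (EuclideanSpace ℝ (Fin 3)), μ = (MeasureTheory.Measure.count : MeasureTheory.Measure (EuclideanSpace ℝ (Fin 3))).restrict S ∧ ∀ x ∈ S, (∀ t r : ℝ, Metric.infDist x (S \ {x}) / 6 < t → r < 3 * Metric.infDist x (S \ {x}) → ∃ s : ℤ → ℤ, Literature.MathematicalPhysics.StatisticalMechanics.IsHaggSeq s ∧ ∃ g : EuclideanSpace ℝ (Fin 3) ≃ᵃⁱ[ℝ] EuclideanSpace ℝ (Fin 3), (∀ y ∈ S, dist x y ≤ r → ∃ z ∈ Literature.MathematicalPhysics.StatisticalMechanics.barlowStacking (Metric.infDist x (S \ {x})) (Metric.infDist x (S \ {x}) * Real.sqrt (2 / 3)) s,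 dist y (g z) ≤ t) ∧ (∀ z ∈ Literature.MathematicalPhysics.StatisticalMechanics.barlowStacking (Metric.infDist x (S \ {x})) (Metric.infDist x (S \ {x}) * Real.sqrt (2 / 3)) s, dist x (g z) ≤ r → ∃ y ∈ S, dist y (g z) ≤ t)) ∧ ((∀ y ∈ S, y ≠ x → dist x y < 107 / 100 * Metric.infDist x (S \ {x}) → dist x y ≤ 101 / 100 * Metric.infDist x (S \ {x})) ∧ ∃ T : Finset (EuclideanSpace ℝ (Fin 3)), (↑T : Set (EuclideanSpace ℝ (Fin 3))) ⊆ {y : EuclideanSpace ℝ (Fin 3) | y ∈ S ∧ y ≠ x ∧ dist x y ≤ 101 / 100 * Metric.infDist x (S \ {x})} ∧ T.card = 12)) → (∀ᵐ μ ∂P, ∃ S : Set (EuclideanSpace ℝ (Fin 3)), μ = (MeasureTheory.Measure.count : MeasureTheory.Measure (EuclideanSpace ℝ (Fin 3))).restrict S ∧ ∀ x ∈ S, ((∀ y ∈ S, dist x y ≤ 2 * Metric.infDist x (S \ {x}) → 13 / 20 * Metric.infDist x (S \ {x}) ≤ Metric.infDist y (S \ {y})) ∧ (∀ y ∈ S,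 y ≠ x → dist x y ≤ 101 / 100 * Metric.infDist x (S \ {x}) → dist x y ≤ 101 / 100 * Metric.infDist y (S \ {y})) ∧ ({y : EuclideanSpace ℝ (Fin 3) | y ∈ S ∧ y ≠ x ∧ dist x y ≤ 101 / 100 * Metric.infDist x (S \ {x})}.ncard = 12) ∧ (∀ t r : ℝ, Metric.infDist x (S \ {x}) / 6 < t → t ≤ 7 / 40 * Metric.infDist x (S \ {x}) → 29 / 10 * Metric.infDist x (S \ {x}) ≤ r → ∀ (s : ℤ → ℤ) (g : EuclideanSpace ℝ (Fin 3) ≃ᵃⁱ[ℝ] EuclideanSpace ℝ (Fin 3)), Literature.MathematicalPhysics.StatisticalMechanics.IsHaggSeq s → (∀ y ∈ S, dist x y ≤ r → ∃ z ∈ Literature.MathematicalPhysics.StatisticalMechanics.barlowStacking (Metric.infDist x (S \ {x})) (Metric.infDist x (S \ {x}) * Real.sqrt (2 / 3)) s, dist y (g z) ≤ t) → (∀ z ∈ Literature.MathematicalPhysics.StatisticalMechanics.barlowStacking (Metric.infDist x (S \ {x})) (Metric.infDist x (S \ {x}) * Real.sqrt (2 / 3)) s, dist x (g z) ≤ r →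 ∃ y ∈ S, dist y (g z) ≤ t) → ∀ y ∈ S, ∀ y' ∈ S, y ≠ x → dist x y ≤ 101 / 100 * Metric.infDist x (S \ {x}) → y' ≠ x → dist x y' ≤ 101 / 100 * Metric.infDist x (S \ {x}) → y ≠ y' → ∀ z ∈ Literature.MathematicalPhysics.StatisticalMechanics.barlowStacking (Metric.infDist x (S \ {x})) (Metric.infDist x (S \ {x}) * Real.sqrt (2 / 3)) s, ∀ z' ∈ Literature.MathematicalPhysics.StatisticalMechanics.barlowStacking (Metric.infDist x (S \ {x})) (Metric.infDist x (S \ {x}) * Real.sqrt (2 / 3)) s, dist y (g z) ≤ t → dist y' (g z') ≤ t → (dist y y' ≤ 101 / 100 * Metric.infDist y (S \ {y}) ↔ dist z z' = Metric.infDist x (S \ {x}))))) → (∫ μ, (∫ y, Literature.MathematicalPhysics.StatisticalMechanics.lennardJones ‖y‖ ∂μ) / 2 ∂P) ≤ Summit.AtomisticToContinuum.Crystallization.Theorems.PalmUnimodularRigidity.LayeredLawsSelectHcp.hcpE a₀ h₀ → (∀ Q : Literature.MathematicalPhysics.StatisticalMechanics.PeriodicConfiguration 3, (∫ μ, (∫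 y, Literature.MathematicalPhysics.StatisticalMechanics.lennardJones ‖y‖ ∂μ) / 2 ∂P) ≤ Q.energyPerParticle Literature.MathematicalPhysics.StatisticalMechanics.lennardJones) → ∀ R θ : ℝ, 0 < R → 0 < θ → P {μ | ∃ S : Set (EuclideanSpace ℝ (Fin 3)), μ = (MeasureTheory.Measure.count : MeasureTheory.Measure (EuclideanSpace ℝ (Fin 3))).restrict S ∧ ∃ A : EuclideanSpace ℝ (Fin 3) ≃ₗᵢ[ℝ] EuclideanSpace ℝ (Fin 3), (∀ y ∈ S, ‖y‖ ≤ R → ∃ z ∈ Literature.MathematicalPhysics.StatisticalMechanics.hcpStacking a₀ h₀, dist y (A z) ≤ θ) ∧ (∀ z ∈ Literature.MathematicalPhysics.StatisticalMechanics.hcpStacking a₀ h₀, ‖z‖ ≤ R → ∃ y ∈ S, dist y (A z) ≤ θ)} ≠ 0) :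
    Summit.AtomisticToContinuum.Crystallization.Theses.PricedLinkCensus.StackingHinge :=
  fun hSLP hCFW => stub_gscpOfSupportCore hCore hSLP hCFW

/-! ## Lead c3's coercive floor implies the support core -/

/-- **`stub_supportCoreOfCoerciveLS`: the registered coercive floor `stub_slpLawCoerciveLS` (lead c3, v30) implies the support core.**
With `E_P[h] ≤ hcpE a₀ h₀` the floor `hcpE a₀ h₀ + κ θ² P(bad_θ) ≤ E_P[h]` makes every radius-3 bad event `P`-null (`θ = 1/(n+1)`), so
a.s. the root window is matched at every tolerance, hence EXACT (`stub_exactWindowOfAllScales`, local finiteness from the hard core),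
hence exact at every point (`stub_allPointsExact`), hence the configuration IS `A '' hcpStacking a₀ h₀` (`stub_hcpLocalExactRigid` with the
three net facts); an a.s. event of a probability law has non-zero measure, and an exact rotated net is matched at every `(R, θ)`. [folklore] -/
theorem stub_supportCoreOfCoerciveLS : (∀ a₀ h₀ : ℝ, 189 / 200 ≤ a₀ → a₀ ≤ 199 / 200 → 77 / 100 ≤ h₀ → h₀ ≤ 163 / 200 → (∀ a h : ℝ, 0 < a → 0 < h → Summit.AtomisticToContinuum.Crystallization.Theorems.PalmUnimodularRigidity.LayeredLawsSelectHcp.hcpE a₀ h₀ ≤ Summit.AtomisticToContinuum.Crystallization.Theorems.PalmUnimodularRigidity.LayeredLawsSelectHcp.hcpE a h) → ∀ δ : ℝ, 0 < δ → ∃ κ : ℝ, 0 < κ ∧ ∀ P : MeasureTheory.Measure (MeasureTheory.Measure (EuclideanSpace ℝ (Fin 3))), MeasureTheory.IsProbabilityMeasure P → (∀ᵐ μ ∂P, (∃ S : Set (EuclideanSpace ℝ (Fin 3)), (0 : EuclideanSpace ℝ (Fin 3)) ∈ S ∧ (∀ x ∈ S, ∀ y ∈ S, x ≠ y → δ ≤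 dist x y) ∧ μ = (MeasureTheory.Measure.count : MeasureTheory.Measure (EuclideanSpace ℝ (Fin 3))).restrict S)) → (∀ g : MeasureTheory.Measure (EuclideanSpace ℝ (Fin 3)) → EuclideanSpace ℝ (Fin 3) → ENNReal, Measurable (Function.uncurry g) → ∫⁻ μ, ∫⁻ y, g μ y ∂μ ∂P = ∫⁻ μ, ∫⁻ y, g (MeasureTheory.Measure.map (fun z => z - y) μ) (-y) ∂μ ∂P) → (∀ᵐ μ ∂P, ∃ S : Set (EuclideanSpace ℝ (Fin 3)), μ = (MeasureTheory.Measure.count : MeasureTheory.Measure (EuclideanSpace ℝ (Fin 3))).restrict S ∧ ∀ x ∈ S, (∀ t r : ℝ, Metric.infDist x (S \ {x}) / 6 < t → r < 3 * Metric.infDist x (S \ {x}) → ∃ s : ℤ → ℤ, Literature.MathematicalPhysics.StatisticalMechanics.IsHaggSeq s ∧ ∃ g : EuclideanSpace ℝ (Fin 3) ≃ᵃⁱ[ℝ] EuclideanSpace ℝ (Fin 3), (∀ y ∈ S, dist x y ≤ r → ∃ z ∈ Literature.MathematicalPhysics.StatisticalMechanics.barlowStacking (Metric.infDist x (S \ {x}))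 (Metric.infDist x (S \ {x}) * Real.sqrt (2 / 3)) s, dist y (g z) ≤ t) ∧ (∀ z ∈ Literature.MathematicalPhysics.StatisticalMechanics.barlowStacking (Metric.infDist x (S \ {x})) (Metric.infDist x (S \ {x}) * Real.sqrt (2 / 3)) s, dist x (g z) ≤ r → ∃ y ∈ S, dist y (g z) ≤ t)) ∧ ((∀ y ∈ S, y ≠ x → dist x y < 107 / 100 * Metric.infDist x (S \ {x}) → dist x y ≤ 101 / 100 * Metric.infDist x (S \ {x})) ∧ ∃ T : Finset (EuclideanSpace ℝ (Fin 3)), (↑T : Set (EuclideanSpace ℝ (Fin 3))) ⊆ {y : EuclideanSpace ℝ (Fin 3) | y ∈ S ∧ y ≠ x ∧ dist x y ≤ 101 / 100 * Metric.infDist x (S \ {x})} ∧ T.card = 12)) → (∀ᵐ μ ∂P, ∃ S : Set (EuclideanSpace ℝ (Fin 3)), μ = (MeasureTheory.Measure.count : MeasureTheory.Measure (EuclideanSpace ℝ (Fin 3))).restrict S ∧ ∀ x ∈ S, ((∀ y ∈ S, dist x y ≤ 2 * Metric.infDist x (S \ {x}) → 13 / 20 * Metric.infDist x (S \ {x}) ≤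 Metric.infDist y (S \ {y})) ∧ (∀ y ∈ S, y ≠ x → dist x y ≤ 101 / 100 * Metric.infDist x (S \ {x}) → dist x y ≤ 101 / 100 * Metric.infDist y (S \ {y})) ∧ ({y : EuclideanSpace ℝ (Fin 3) | y ∈ S ∧ y ≠ x ∧ dist x y ≤ 101 / 100 * Metric.infDist x (S \ {x})}.ncard = 12) ∧ (∀ t r : ℝ, Metric.infDist x (S \ {x}) / 6 < t → t ≤ 7 / 40 * Metric.infDist x (S \ {x}) → 29 / 10 * Metric.infDist x (S \ {x}) ≤ r → ∀ (s : ℤ → ℤ) (g : EuclideanSpace ℝ (Fin 3) ≃ᵃⁱ[ℝ] EuclideanSpace ℝ (Fin 3)), Literature.MathematicalPhysics.StatisticalMechanics.IsHaggSeq s → (∀ y ∈ S, dist x y ≤ r → ∃ z ∈ Literature.MathematicalPhysics.StatisticalMechanics.barlowStacking (Metric.infDist x (S \ {x})) (Metric.infDist x (S \ {x}) * Real.sqrt (2 / 3)) s, dist y (g z) ≤ t) → (∀ z ∈ Literature.MathematicalPhysics.StatisticalMechanics.barlowStacking (Metric.infDist x (S \ {x})) (Metric.infDist x (S \ {x}) *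 Real.sqrt (2 / 3)) s, dist x (g z) ≤ r → ∃ y ∈ S, dist y (g z) ≤ t) → ∀ y ∈ S, ∀ y' ∈ S, y ≠ x → dist x y ≤ 101 / 100 * Metric.infDist x (S \ {x}) → y' ≠ x → dist x y' ≤ 101 / 100 * Metric.infDist x (S \ {x}) → y ≠ y' → ∀ z ∈ Literature.MathematicalPhysics.StatisticalMechanics.barlowStacking (Metric.infDist x (S \ {x})) (Metric.infDist x (S \ {x}) * Real.sqrt (2 / 3)) s, ∀ z' ∈ Literature.MathematicalPhysics.StatisticalMechanics.barlowStacking (Metric.infDist x (S \ {x})) (Metric.infDist x (S \ {x}) * Real.sqrt (2 / 3)) s, dist y (g z) ≤ t → dist y' (g z') ≤ t → (dist y y' ≤ 101 / 100 * Metric.infDist y (S \ {y}) ↔ dist z z' = Metric.infDist x (S \ {x}))))) → ∀ θ : ℝ, 0 < θ → θ ≤ 1 → Summit.AtomisticToContinuum.Crystallization.Theorems.PalmUnimodularRigidity.LayeredLawsSelectHcp.hcpE a₀ h₀ + κ * θ ^ 2 * (P {μ | ∃ S : Set (EuclideanSpace ℝ (Fin 3)), μ = (MeasureTheory.Measure.count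 : MeasureTheory.Measure (EuclideanSpace ℝ (Fin 3))).restrict S ∧ ¬ ∃ A : EuclideanSpace ℝ (Fin 3) ≃ₗᵢ[ℝ] EuclideanSpace ℝ (Fin 3), ((∀ y ∈ S, ‖y‖ ≤ 3 → ∃ z ∈ Literature.MathematicalPhysics.StatisticalMechanics.hcpStacking a₀ h₀, dist y (A z) ≤ θ) ∧ (∀ z ∈ Literature.MathematicalPhysics.StatisticalMechanics.hcpStacking a₀ h₀, ‖z‖ ≤ 3 → ∃ y ∈ S, dist y (A z) ≤ θ))}).toReal ≤ (∫ μ, (∫ y, Literature.MathematicalPhysics.StatisticalMechanics.lennardJones ‖y‖ ∂μ) / 2 ∂P)) → (∀ a₀ h₀ : ℝ, 189 / 200 ≤ a₀ → a₀ ≤ 199 / 200 → 77 / 100 ≤ h₀ → h₀ ≤ 163 / 200 → (∀ a h : ℝ, 0 < a → 0 < h → Summit.AtomisticToContinuum.Crystallization.Theorems.PalmUnimodularRigidity.LayeredLawsSelectHcp.hcpE a₀ h₀ ≤ Summit.AtomisticToContinuum.Crystallization.Theorems.PalmUnimodularRigidity.LayeredLawsSelectHcp.hcpE a h) → ∀ δ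 : ℝ, 0 < δ → ∀ P : MeasureTheory.Measure (MeasureTheory.Measure (EuclideanSpace ℝ (Fin 3))), MeasureTheory.IsProbabilityMeasure P → (∀ᵐ μ ∂P, (∃ S : Set (EuclideanSpace ℝ (Fin 3)), (0 : EuclideanSpace ℝ (Fin 3)) ∈ S ∧ (∀ x ∈ S, ∀ y ∈ S, x ≠ y → δ ≤ dist x y) ∧ μ = (MeasureTheory.Measure.count : MeasureTheory.Measure (EuclideanSpace ℝ (Fin 3))).restrict S)) → (∀ g : MeasureTheory.Measure (EuclideanSpace ℝ (Fin 3)) → EuclideanSpace ℝ (Fin 3) → ENNReal, Measurable (Function.uncurry g) → ∫⁻ μ, ∫⁻ y, g μ y ∂μ ∂P = ∫⁻ μ, ∫⁻ y, g (MeasureTheory.Measure.map (fun z => z - y) μ) (-y) ∂μ ∂P) → (∀ᵐ μ ∂P, ∃ S : Set (EuclideanSpace ℝ (Fin 3)), μ = (MeasureTheory.Measure.count : MeasureTheory.Measure (EuclideanSpace ℝ (Fin 3))).restrict S ∧ ∀ x ∈ S, (∀ t r : ℝ, Metric.infDist x (S \ {x}) / 6 < t → r < 3 * Metric.infDist x (S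 \ {x}) → ∃ s : ℤ → ℤ, Literature.MathematicalPhysics.StatisticalMechanics.IsHaggSeq s ∧ ∃ g : EuclideanSpace ℝ (Fin 3) ≃ᵃⁱ[ℝ] EuclideanSpace ℝ (Fin 3), (∀ y ∈ S, dist x y ≤ r → ∃ z ∈ Literature.MathematicalPhysics.StatisticalMechanics.barlowStacking (Metric.infDist x (S \ {x})) (Metric.infDist x (S \ {x}) * Real.sqrt (2 / 3)) s, dist y (g z) ≤ t) ∧ (∀ z ∈ Literature.MathematicalPhysics.StatisticalMechanics.barlowStacking (Metric.infDist x (S \ {x})) (Metric.infDist x (S \ {x}) * Real.sqrt (2 / 3)) s, dist x (g z) ≤ r → ∃ y ∈ S, dist y (g z) ≤ t)) ∧ ((∀ y ∈ S, y ≠ x → dist x y < 107 / 100 * Metric.infDist x (S \ {x}) → dist x y ≤ 101 / 100 * Metric.infDist x (S \ {x})) ∧ ∃ T : Finset (EuclideanSpace ℝ (Fin 3)), (↑T : Set (EuclideanSpace ℝ (Fin 3))) ⊆ {y : EuclideanSpace ℝ (Fin 3) | y ∈ S ∧ y ≠ x ∧ dist x y ≤ 101 / 100 * Metric.infDist x (S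 \ {x})} ∧ T.card = 12)) → (∀ᵐ μ ∂P, ∃ S : Set (EuclideanSpace ℝ (Fin 3)), μ = (MeasureTheory.Measure.count : MeasureTheory.Measure (EuclideanSpace ℝ (Fin 3))).restrict S ∧ ∀ x ∈ S, ((∀ y ∈ S, dist x y ≤ 2 * Metric.infDist x (S \ {x}) → 13 / 20 * Metric.infDist x (S \ {x}) ≤ Metric.infDist y (S \ {y})) ∧ (∀ y ∈ S, y ≠ x → dist x y ≤ 101 / 100 * Metric.infDist x (S \ {x}) → dist x y ≤ 101 / 100 * Metric.infDist y (S \ {y})) ∧ ({y : EuclideanSpace ℝ (Fin 3) | y ∈ S ∧ y ≠ x ∧ dist x y ≤ 101 / 100 * Metric.infDist x (S \ {x})}.ncard = 12) ∧ (∀ t r : ℝ, Metric.infDist x (S \ {x}) / 6 < t → t ≤ 7 / 40 * Metric.infDist x (S \ {x}) → 29 / 10 * Metric.infDist x (S \ {x}) ≤ r → ∀ (s : ℤ → ℤ) (g : EuclideanSpace ℝ (Fin 3) ≃ᵃⁱ[ℝ] EuclideanSpace ℝ (Fin 3)), Literature.MathematicalPhysics.StatisticalMechanics.IsHaggSeq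 s → (∀ y ∈ S, dist x y ≤ r → ∃ z ∈ Literature.MathematicalPhysics.StatisticalMechanics.barlowStacking (Metric.infDist x (S \ {x})) (Metric.infDist x (S \ {x}) * Real.sqrt (2 / 3)) s, dist y (g z) ≤ t) → (∀ z ∈ Literature.MathematicalPhysics.StatisticalMechanics.barlowStacking (Metric.infDist x (S \ {x})) (Metric.infDist x (S \ {x}) * Real.sqrt (2 / 3)) s, dist x (g z) ≤ r → ∃ y ∈ S, dist y (g z) ≤ t) → ∀ y ∈ S, ∀ y' ∈ S, y ≠ x → dist x y ≤ 101 / 100 * Metric.infDist x (S \ {x}) → y' ≠ x → dist x y' ≤ 101 / 100 * Metric.infDist x (S \ {x}) → y ≠ y' → ∀ z ∈ Literature.MathematicalPhysics.StatisticalMechanics.barlowStacking (Metric.infDist x (S \ {x})) (Metric.infDist x (S \ {x}) * Real.sqrt (2 / 3)) s, ∀ z' ∈ Literature.MathematicalPhysics.StatisticalMechanics.barlowStacking (Metric.infDist x (S \ {x})) (Metric.infDist x (S \ {x}) * Real.sqrt (2 / 3)) s, dist y (g z) ≤ t → dist y' (g z') ≤ t → (dist y y' ≤ 101 / 100 * Metric.infDist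 y (S \ {y}) ↔ dist z z' = Metric.infDist x (S \ {x}))))) → (∫ μ, (∫ y, Literature.MathematicalPhysics.StatisticalMechanics.lennardJones ‖y‖ ∂μ) / 2 ∂P) ≤ Summit.AtomisticToContinuum.Crystallization.Theorems.PalmUnimodularRigidity.LayeredLawsSelectHcp.hcpE a₀ h₀ → (∀ Q : Literature.MathematicalPhysics.StatisticalMechanics.PeriodicConfiguration 3, (∫ μ, (∫ y, Literature.MathematicalPhysics.StatisticalMechanics.lennardJones ‖y‖ ∂μ) / 2 ∂P) ≤ Q.energyPerParticle Literature.MathematicalPhysics.StatisticalMechanics.lennardJones) → ∀ R θ : ℝ, 0 < R → 0 < θ → P {μ | ∃ S : Set (EuclideanSpace ℝ (Fin 3)), μ = (MeasureTheory.Measure.count : MeasureTheory.Measure (EuclideanSpace ℝ (Fin 3))).restrict S ∧ ∃ A : EuclideanSpace ℝ (Fin 3) ≃ₗᵢ[ℝ] EuclideanSpace ℝ (Fin 3), (∀ y ∈ S, ‖y‖ ≤ R → ∃ z ∈ Literature.MathematicalPhysics.StatisticalMechanics.hcpStacking a₀ h₀, dist y (A z) ≤ θ) ∧ (∀ z ∈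 Literature.MathematicalPhysics.StatisticalMechanics.hcpStacking a₀ h₀, ‖z‖ ≤ R → ∃ y ∈ S, dist y (A z) ≤ θ)} ≠ 0) := by
  intro hLSfloor a₀ h₀ hb1 hb2 hb3 hb4 hglob δ hδ P hP hcore hstat hgood hLS hle _hper R θ _hR hθ
  have ha₀ : 0 < a₀ := by linarith
  have hh₀ : 0 < h₀ := by linarith
  obtain ⟨κ, hκ, hcoer⟩ := hLSfloor a₀ h₀ hb1 hb2 hb3 hb4 hglob δ hδ
  -- every radius-3 bad event is `P`-null
  have hnull : ∀ n : ℕ, P {μ | ∃ S : Set (EuclideanSpace ℝ (Fin 3)), μ = (MeasureTheory.Measure.count : MeasureTheory.Measure (EuclideanSpace ℝ (Fin 3))).restrict S ∧ ¬ ∃ A : EuclideanSpace ℝ (Fin 3) ≃ₗᵢ[ℝ] EuclideanSpace ℝ (Fin 3), ((∀ y ∈ S, ‖y‖ ≤ 3 → ∃ z ∈ Literature.MathematicalPhysics.StatisticalMechanics.hcpStacking a₀ h₀, dist y (A z) ≤ 1 / ((n : ℝ) + 1)) ∧ (∀ z ∈ Literature.MathematicalPhysics.StatisticalMechanics.hcpStacking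 a₀ h₀, ‖z‖ ≤ 3 → ∃ y ∈ S, dist y (A z) ≤ 1 / ((n : ℝ) + 1)))} = 0 := by
    intro n
    have hθ' : (0 : ℝ) < 1 / ((n : ℝ) + 1) := by positivity
    have hθ1 : 1 / ((n : ℝ) + 1) ≤ 1 := by
      rw [div_le_one (by positivity)]
      linarith [n.cast_nonneg (α := ℝ)]
    have h1 := hcoer P hP hcore hstat hgood hLS _ hθ' hθ1
    have h3 : (P {μ | ∃ S : Set (EuclideanSpace ℝ (Fin 3)), μ = (MeasureTheory.Measure.count : MeasureTheory.Measure (EuclideanSpace ℝ (Fin 3))).restrict S ∧ ¬ ∃ A : EuclideanSpace ℝ (Fin 3) ≃ₗᵢ[ℝ] EuclideanSpace ℝ (Fin 3), ((∀ y ∈ S, ‖y‖ ≤ 3 → ∃ z ∈ Literature.MathematicalPhysics.StatisticalMechanics.hcpStacking a₀ h₀, dist y (A z) ≤ 1 / ((n : ℝ) + 1)) ∧ (∀ z ∈ Literature.MathematicalPhysics.StatisticalMechanics.hcpStacking a₀ h₀, ‖z‖ ≤ 3 → ∃ y ∈ S, dist y (A z) ≤ 1 / ((n : ℝ) + 1)))}).toReal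 ≤ 0 := by
      by_contra hcon'
      have hcon := not_le.1 hcon'
      have : 0 < κ * (1 / ((n : ℝ) + 1)) ^ 2 * (P {μ | ∃ S : Set (EuclideanSpace ℝ (Fin 3)), μ = (MeasureTheory.Measure.count : MeasureTheory.Measure (EuclideanSpace ℝ (Fin 3))).restrict S ∧ ¬ ∃ A : EuclideanSpace ℝ (Fin 3) ≃ₗᵢ[ℝ] EuclideanSpace ℝ (Fin 3), ((∀ y ∈ S, ‖y‖ ≤ 3 → ∃ z ∈ Literature.MathematicalPhysics.StatisticalMechanics.hcpStacking a₀ h₀, dist y (A z) ≤ 1 / ((n : ℝ) + 1)) ∧ (∀ z ∈ Literature.MathematicalPhysics.StatisticalMechanics.hcpStacking a₀ h₀, ‖z‖ ≤ 3 → ∃ y ∈ S, dist y (A z) ≤ 1 / ((n : ℝ) + 1)))}).toReal :=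
        mul_pos (mul_pos hκ (by positivity)) hcon
      linarith
    have h4 : (P {μ | ∃ S : Set (EuclideanSpace ℝ (Fin 3)), μ = (MeasureTheory.Measure.count : MeasureTheory.Measure (EuclideanSpace ℝ (Fin 3))).restrict S ∧ ¬ ∃ A : EuclideanSpace ℝ (Fin 3) ≃ₗᵢ[ℝ] EuclideanSpace ℝ (Fin 3), ((∀ y ∈ S, ‖y‖ ≤ 3 → ∃ z ∈ Literature.MathematicalPhysics.StatisticalMechanics.hcpStacking a₀ h₀, dist y (A z) ≤ 1 / ((n : ℝ) + 1)) ∧ (∀ z ∈ Literature.MathematicalPhysics.StatisticalMechanics.hcpStacking a₀ h₀, ‖z‖ ≤ 3 → ∃ y ∈ S, dist y (A z) ≤ 1 / ((n : ℝ) + 1)))}).toReal = 0 := le_antisymm h3 ENNReal.toReal_nonneg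
    exact (ENNReal.toReal_eq_zero_iff _).1 h4 |>.resolve_right (MeasureTheory.measure_ne_top P _)
  -- a.s. the root window is matched at every tolerance `1/(n+1)`
  have hae : ∀ᵐ μ ∂P, ∀ n : ℕ, μ ∉ {μ | ∃ S : Set (EuclideanSpace ℝ (Fin 3)), μ = (MeasureTheory.Measure.count : MeasureTheory.Measure (EuclideanSpace ℝ (Fin 3))).restrict S ∧ ¬ ∃ A : EuclideanSpace ℝ (Fin 3) ≃ₗᵢ[ℝ] EuclideanSpace ℝ (Fin 3), ((∀ y ∈ S, ‖y‖ ≤ 3 → ∃ z ∈ Literature.MathematicalPhysics.StatisticalMechanics.hcpStacking a₀ h₀, dist y (A z) ≤ 1 / ((n : ℝ) + 1)) ∧ (∀ z ∈ Literature.MathematicalPhysics.StatisticalMechanics.hcpStacking a₀ h₀, ‖z‖ ≤ 3 → ∃ y ∈ S, dist y (A z) ≤ 1 / ((n : ℝ) + 1)))} :=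
    MeasureTheory.ae_all_iff.2 fun n => (MeasureTheory.measure_eq_zero_iff_ae_notMem).1 (hnull n)
  -- hence a.s. EXACT at the root
  have hroot : ∀ᵐ μ ∂P, ∃ S : Set (EuclideanSpace ℝ (Fin 3)), μ = (MeasureTheory.Measure.count : MeasureTheory.Measure (EuclideanSpace ℝ (Fin 3))).restrict S ∧ (0 : EuclideanSpace ℝ (Fin 3)) ∈ S ∧ ∃ A : EuclideanSpace ℝ (Fin 3) ≃ₗᵢ[ℝ] EuclideanSpace ℝ (Fin 3), ((∀ y ∈ S, ‖y‖ ≤ 3 → ∃ z ∈ Literature.MathematicalPhysics.StatisticalMechanics.hcpStacking a₀ h₀, y = A z) ∧ (∀ z ∈ Literature.MathematicalPhysics.StatisticalMechanics.hcpStacking a₀ h₀, ‖z‖ ≤ 3 → A z ∈ S)) := by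
    filter_upwards [hcore, hae] with μ hc hn
    obtain ⟨S, h0, hsep, rfl⟩ := hc
    refine ⟨S, rfl, h0, ?_⟩
    have hfin : ∀ r : ℝ, (Metric.closedBall (0 : EuclideanSpace ℝ (Fin 3)) r ∩ S).Finite := fun r =>
      Literature.Probability.Process.LocalConfig.finite_inter_of_separated hδ hsep (isCompact_closedBall _ _)
    refine PricedHcpWindowsExactWindow.stub_exactWindowOfAllScales a₀ h₀ ha₀ hh₀ S hfin fun n => ?_
    by_contra hcon
    exact hn n ⟨S, rfl, hcon⟩
  -- hence a.s. exact at EVERY point, and the configuration is a rotated net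
  have hall := PricedHcpWindowsAllPointsExact.stub_allPointsExact a₀ h₀ δ hδ P hP hcore hstat hroot
  have hexact : ∀ᵐ μ ∂P, ∃ A : EuclideanSpace ℝ (Fin 3) ≃ₗᵢ[ℝ] EuclideanSpace ℝ (Fin 3),
      μ = (MeasureTheory.Measure.count : MeasureTheory.Measure (EuclideanSpace ℝ (Fin 3))).restrict
        (A '' Literature.MathematicalPhysics.StatisticalMechanics.hcpStacking a₀ h₀) := by
    filter_upwards [hcore, hall] with μ hc ha
    obtain ⟨S, h0, -, rfl⟩ := hc
    obtain ⟨S', hS', hwin⟩ := ha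
    obtain rfl := PricedHcpWindowsAllPointsOfRoot.eq_of_count_restrict_eq hS'
    obtain ⟨A, hA⟩ := PricedHcpWindowsHcpLocalExactRigid.stub_hcpLocalExactRigid
      PricedHcpWindowsHcpContinuation.stub_hcpContinuationUnique PricedHcpWindowsHcpRootTransitive.stub_hcpRootTransitive
      PricedHcpWindowsHcpNetFacts.stub_hcpNetFacts a₀ h₀ hb1 hb2 hb3 hb4 S h0 hwin
    exact ⟨A, by rw [← hA]⟩
  -- an a.s. event has non-zero measure; an exact rotated net is matched at every `(R, θ)`
  intro h0
  have hnot : ∀ᵐ μ ∂P, μ ∉ {μ | ∃ S : Set (EuclideanSpace ℝ (Fin 3)), μ = (MeasureTheory.Measure.count : MeasureTheory.Measure (EuclideanSpace ℝ (Fin 3))).restrict S ∧ ∃ A : EuclideanSpace ℝ (Fin 3) ≃ₗᵢ[ℝ] EuclideanSpace ℝ (Fin 3), (∀ y ∈ S, ‖y‖ ≤ R → ∃ z ∈ Literature.MathematicalPhysics.StatisticalMechanics.hcpStacking a₀ h₀, dist y (A z) ≤ θ) ∧ (∀ z ∈ Literature.MathematicalPhysics.StatisticalMechanics.hcpStacking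 a₀ h₀, ‖z‖ ≤ R → ∃ y ∈ S, dist y (A z) ≤ θ)} :=
    (MeasureTheory.measure_eq_zero_iff_ae_notMem).1 h0
  haveI : (MeasureTheory.ae P).NeBot := MeasureTheory.ae_neBot.2 (IsProbabilityMeasure.ne_zero P)
  obtain ⟨μ, ⟨A, rfl⟩, hμ⟩ := (hexact.and hnot).exists
  refine hμ ⟨A '' Literature.MathematicalPhysics.StatisticalMechanics.hcpStacking a₀ h₀, rfl, A, ?_, ?_⟩
  · rintro y ⟨z, hz, rfl⟩ _
    exact ⟨z, hz, by simp [hθ.le]⟩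
  · intro z hz _
    exact ⟨A z, ⟨z, hz, rfl⟩, by simp [hθ.le]⟩

end Summit.AtomisticToContinuum.Crystallization.Theorems.PricedHcpWindowsSupportCore

end
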